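import Summits.QuantumFields.BalabanUV.Beta.FP.LatticeTaylorPath
import Literature.MathematicalPhysics.QuantumFieldTheory.Balaban1983to89.Beta.ExpKernelCalculus

/-!
# `BalabanUV.Beta.FP.LatticeTaylorIndex` — THE FINITE INDEX OF THE ORDER-TWO DISCRETE TAYLOR POLYNOMIAL ON `ℤ^D`: monomials `mono ι s` and difference
# operators `dOp ι` over `Idx D := Unit ⊕ Fin D ⊕ Fin D ⊕ (Fin D × Fin D)`, the repackaged bound `|f (p+s) − Σ_ι mono ι s · dOp ι f p| ≤ D(D+1)²R³B`,
# and the weight bound `|mono ι s| ≤ (|s|₁ + 1)²` (road «FP», LEGS generic Taylor-pairing track, module (T) part 3; [folklore])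

HONEST DEPENDENCY (page 1, mandatory): continuum YM on T⁴ ⇐ BetaPertH ∧ nine spine estimates (0/9 proved); BetaPertH ⇐ (D1) ∧ (D4) ∧
CAP+tail; G-an2-4 gates asym, D1 and NE2/3/4.  HONEST FRAMING (cell contract, verbatim): «discharging `BetaPertH` makes Bałaban's UV
stability UNCONDITIONAL — a real constructive-QFT result; it is NOT the continuum limit and NOT the Clay problem.»  THIS MODULE is elementary
[folklore] bookkeeping on the integer lattice; it asserts nothing about Bałaban's objects, cites nothing, mints no `Prop` fact; TWO DATA `def`s (`mono`, `dOp`: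
the monomials and the forward-difference words of the order-two Taylor polynomial, indexed by a finite type), 0 sorry.  Value = the TABLE INDEX of the LEGS
pairing: a bubble of two exponentially localised stencils through a leg expanded to second order is a FINITE sum over `Idx D × Idx D` (× fibre) of products of
smeared difference legs — finitely many structures, as the `hrep` ∕ `hlegs` binder of road FP's N7 END requires.  NOT D1, NOT BetaPertH, NOT continuum, NOT Clay.

WHAT IS HERE.
* `Idx D := Unit ⊕ Fin D ⊕ Fin D ⊕ (Fin D × Fin D)` (orders 0, 1, 2 diagonal, 2 mixed); `mono ι s ∈ {1, s_k, s_k(s_k−1)/2, s_k·(trunc k s)_i}` (the mixed monomial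
  vanishes unless `i < k`); `dOp ι f ∈ {f, Δ_k f, Δ_kΔ_k f, Δ_iΔ_k f}` (`Δ_k = fwdDiff (Pi.single k 1)`);
* `taylorPoly_eq_sum_mono`: the order-two Taylor polynomial of `LatticeTaylorPath.abs_taylor2D_le` IS `Σ_ι mono ι s · dOp ι f p`;
* **`abs_sub_sum_mono_le`**: `|f (p + s) − Σ_ι mono ι s · dOp ι f p| ≤ D(D+1)²·R³·B` (third differences bounded by `B` on the coordinate box of radius `R`, `|s_i| ≤ R`);
* `abs_mono_le`: `|mono ι s| ≤ (|s|₁ + 1)²` (`|s|₁ = B12Sec2to5.l1 s`), the weight class consumed by `FP/StencilMoments`.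
Unit `b2b-balaban-beta-d1-formalise-leaf-02` (gen 5).
-/

noncomputable section

namespace Summit.QuantumFields.BalabanUV.Beta.FP.LatticeTaylorIndex

open Finset fwdDiff
open Literature.MathematicalPhysics.QuantumFieldTheory.Balaban1983to89.B12Sec2to5 (l1 l1_nonneg)
open Summit.QuantumFields.BalabanUV.Beta.FP.LatticeTaylorPath (trunc trunc_apply abs_trunc_le abs_taylor2D_le)

variable {D : ℕ}

/-- [folklore] The finite index of the order-two Taylor polynomial: order 0 ∣ order 1 (`k`) ∣ order 2 diagonal (`k`) ∣ order 2 mixed (`(i, k)`, live for `i < k`). -/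
abbrev Idx (D : ℕ) : Type := Unit ⊕ Fin D ⊕ Fin D ⊕ (Fin D × Fin D)

/-- [folklore] The MONOMIALS of the order-two Taylor polynomial along the coordinate path: `1`, `s_k`, `s_k(s_k−1)/2`, `s_k·(trunc k s)_i`. -/
def mono : Idx D → (Fin D → ℤ) → ℝ
  | Sum.inl _ => fun _ => 1
  | Sum.inr (Sum.inl k) => fun s => (s k : ℝ)
  | Sum.inr (Sum.inr (Sum.inl k)) => fun s => (s k : ℝ) * ((s k : ℝ) - 1) / 2
  | Sum.inr (Sum.inr (Sum.inr ik)) => fun s => (s ik.2 : ℝ) * (trunc ik.2 s ik.1 : ℝ)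

/-- [folklore] The FORWARD-DIFFERENCE WORDS of the order-two Taylor polynomial: `id`, `Δ_k`, `Δ_kΔ_k`, `Δ_iΔ_k`. -/
def dOp : Idx D → ((Fin D → ℤ) → ℝ) → (Fin D → ℤ) → ℝ
  | Sum.inl _ => fun f => f
  | Sum.inr (Sum.inl k) => fun f => Δ_[(Pi.single k 1 : Fin D → ℤ)] f
  | Sum.inr (Sum.inr (Sum.inl k)) => fun f => Δ_[(Pi.single k 1 : Fin D → ℤ)] (Δ_[(Pi.single k 1 : Fin D → ℤ)] f)
  | Sum.inr (Sum.inr (Sum.inr ik)) => fun f => Δ_[(Pi.single ik.1 1 : Fin D → ℤ)] (Δ_[(Pi.single ik.2 1 : Fin D → ℤ)] f)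

/-- [folklore] Computation rule. -/
@[simp] theorem mono_inl (u : Unit) (s : Fin D → ℤ) : mono (Sum.inl u : Idx D) s = 1 := rfl
/-- [folklore] Computation rule. -/
@[simp] theorem mono_inr_inl (k : Fin D) (s : Fin D → ℤ) : mono (Sum.inr (Sum.inl k) : Idx D) s = (s k : ℝ) := rfl
/-- [folklore] Computation rule. -/
@[simp] theorem mono_inr_inr_inl (k : Fin D) (s : Fin D → ℤ) :
    mono (Sum.inr (Sum.inr (Sum.inl k)) : Idx D) s = (s k : ℝ) * ((s k : ℝ) - 1) / 2 := rfl
/-- [folklore] Computation rule. -/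
@[simp] theorem mono_inr_inr_inr (i k : Fin D) (s : Fin D → ℤ) :
    mono (Sum.inr (Sum.inr (Sum.inr (i, k))) : Idx D) s = (s k : ℝ) * (trunc k s i : ℝ) := rfl
/-- [folklore] Computation rule. -/
@[simp] theorem dOp_inl (u : Unit) (f : (Fin D → ℤ) → ℝ) : dOp (Sum.inl u : Idx D) f = f := rfl
/-- [folklore] Computation rule. -/
@[simp] theorem dOp_inr_inl (k : Fin D) (f : (Fin D → ℤ) → ℝ) : dOp (Sum.inr (Sum.inl k) : Idx D) f = Δ_[(Pi.single k 1 : Fin D → ℤ)] f := rfl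
/-- [folklore] Computation rule. -/
@[simp] theorem dOp_inr_inr_inl (k : Fin D) (f : (Fin D → ℤ) → ℝ) :
    dOp (Sum.inr (Sum.inr (Sum.inl k)) : Idx D) f = Δ_[(Pi.single k 1 : Fin D → ℤ)] (Δ_[(Pi.single k 1 : Fin D → ℤ)] f) := rfl
/-- [folklore] Computation rule. -/
@[simp] theorem dOp_inr_inr_inr (i k : Fin D) (f : (Fin D → ℤ) → ℝ) :
    dOp (Sum.inr (Sum.inr (Sum.inr (i, k))) : Idx D) f = Δ_[(Pi.single i 1 : Fin D → ℤ)] (Δ_[(Pi.single k 1 : Fin D → ℤ)] f) := rfl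

/-- [folklore] The zero displacement kills every monomial except the order-zero one. -/
theorem mono_zero (ι : Idx D) : mono ι (0 : Fin D → ℤ) = if ι = Sum.inl () then 1 else 0 := by
  rcases ι with u | k | k | ⟨i, k⟩
  · simp
  · simp
  · simp
  · simp

/-- [folklore] **THE ORDER-TWO TAYLOR POLYNOMIAL IS THE FINITE SUM `Σ_ι mono ι s · dOp ι f p`.** -/
theorem taylorPoly_eq_sum_mono (f : (Fin D → ℤ) → ℝ) (p s : Fin D → ℤ) :
    f p + ∑ k : Fin D, (s k : ℝ) * Δ_[(Pi.single k 1 : Fin D → ℤ)] f p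
        + ∑ k : Fin D, ((s k : ℝ) * ((s k : ℝ) - 1) / 2) * Δ_[(Pi.single k 1 : Fin D → ℤ)] (Δ_[(Pi.single k 1 : Fin D → ℤ)] f) p
        + ∑ k : Fin D, ∑ i : Fin D, (s k : ℝ) * (trunc k s i : ℝ) * Δ_[(Pi.single i 1 : Fin D → ℤ)] (Δ_[(Pi.single k 1 : Fin D → ℤ)] f) p
      = ∑ ι : Idx D, mono ι s * dOp ι f p := by
  rw [Fintype.sum_sum_type, Fintype.sum_sum_type, Fintype.sum_sum_type, Fintype.sum_prod_type]
  simp only [Finset.univ_unique, Finset.sum_singleton, mono_inl, dOp_inl, one_mul, mono_inr_inl, dOp_inr_inl, mono_inr_inr_inl,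
    dOp_inr_inr_inl, mono_inr_inr_inr, dOp_inr_inr_inr]
  rw [Finset.sum_comm (f := fun (k : Fin D) (i : Fin D) =>
    (s k : ℝ) * (trunc k s i : ℝ) * Δ_[(Pi.single i 1 : Fin D → ℤ)] (Δ_[(Pi.single k 1 : Fin D → ℤ)] f) p)]
  ring

/-- **ORDER-TWO DISCRETE TAYLOR ON `ℤ^D`, FINITE-INDEX FORM**: `|f (p + s) − Σ_ι mono ι s · dOp ι f p| ≤ D(D+1)²·R³·B` when every third difference of `f` is
bounded by `B` on the coordinate box of radius `R` around `p` and `|s_i| ≤ R` (`LatticeTaylorPath.abs_taylor2D_le`). [folklore] -/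
theorem abs_sub_sum_mono_le (f : (Fin D → ℤ) → ℝ) (p s : Fin D → ℤ) {R : ℕ} (hs : ∀ i, |s i| ≤ (R : ℤ)) {B : ℝ} (hB : 0 ≤ B)
    (h : ∀ x : Fin D → ℤ, (∀ i, |x i - p i| ≤ (R : ℤ)) → ∀ i j k : Fin D,
      |Δ_[(Pi.single i 1 : Fin D → ℤ)] (Δ_[(Pi.single j 1 : Fin D → ℤ)] (Δ_[(Pi.single k 1 : Fin D → ℤ)] f)) x| ≤ B) :
    |f (p + s) - ∑ ι : Idx D, mono ι s * dOp ι f p| ≤ (D : ℝ) * ((D : ℝ) + 1) ^ 2 * (R : ℝ) ^ 3 * B := by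
  rw [← taylorPoly_eq_sum_mono]
  have := abs_taylor2D_le f p s hs hB h
  have e : f (p + s) - (f p + ∑ k : Fin D, (s k : ℝ) * Δ_[(Pi.single k 1 : Fin D → ℤ)] f p
        + ∑ k : Fin D, ((s k : ℝ) * ((s k : ℝ) - 1) / 2) * Δ_[(Pi.single k 1 : Fin D → ℤ)] (Δ_[(Pi.single k 1 : Fin D → ℤ)] f) p
        + ∑ k : Fin D, ∑ i : Fin D, (s k : ℝ) * (trunc k s i : ℝ) * Δ_[(Pi.single i 1 : Fin D → ℤ)] (Δ_[(Pi.single k 1 : Fin D → ℤ)] f) p)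
      = f (p + s) - f p - ∑ k : Fin D, (s k : ℝ) * Δ_[(Pi.single k 1 : Fin D → ℤ)] f p
        - ∑ k : Fin D, ((s k : ℝ) * ((s k : ℝ) - 1) / 2) * Δ_[(Pi.single k 1 : Fin D → ℤ)] (Δ_[(Pi.single k 1 : Fin D → ℤ)] f) p
        - ∑ k : Fin D, ∑ i : Fin D, (s k : ℝ) * (trunc k s i : ℝ) * Δ_[(Pi.single i 1 : Fin D → ℤ)] (Δ_[(Pi.single k 1 : Fin D → ℤ)] f) p := by
    ring
  rw [e]
  exact this

/-- [folklore] A coordinate is at most the ℓ¹ size: `|s_k| ≤ |s|₁`. -/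
theorem abs_coord_le_l1 (s : Fin D → ℤ) (k : Fin D) : |(s k : ℝ)| ≤ l1 s :=
  Finset.single_le_sum (f := fun μ => |(s μ : ℝ)|) (fun _ _ => abs_nonneg _) (Finset.mem_univ k)

/-- **THE WEIGHT CLASS OF THE MONOMIALS**: `|mono ι s| ≤ (|s|₁ + 1)²` for every index. [folklore] -/
theorem abs_mono_le (ι : Idx D) (s : Fin D → ℤ) : |mono ι s| ≤ (l1 s + 1) ^ 2 := by
  have hL := l1_nonneg s
  rcases ι with u | k | k | ⟨i, k⟩
  · simp only [mono_inl, abs_one]; nlinarith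
  · simp only [mono_inr_inl]
    have := abs_coord_le_l1 s k
    nlinarith
  · simp only [mono_inr_inr_inl]
    have hk := abs_coord_le_l1 s k
    rw [abs_div, abs_mul, abs_two]
    have h1 : |(s k : ℝ) - 1| ≤ l1 s + 1 := (abs_sub _ _).trans (by rw [abs_one]; linarith)
    have : |(s k : ℝ)| * |(s k : ℝ) - 1| ≤ l1 s * (l1 s + 1) := mul_le_mul hk h1 (abs_nonneg _) hL
    nlinarith
  · simp only [mono_inr_inr_inr]
    rw [abs_mul]
    have hk := abs_coord_le_l1 s k
    have hi : |((trunc k s i : ℤ) : ℝ)| ≤ l1 s := by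
      have h1 : |((trunc k s i : ℤ) : ℝ)| ≤ |(s i : ℝ)| := by exact_mod_cast abs_trunc_le k s i
      exact h1.trans (abs_coord_le_l1 s i)
    have : |(s k : ℝ)| * |((trunc k s i : ℤ) : ℝ)| ≤ l1 s * l1 s := mul_le_mul hk hi (abs_nonneg _) hL
    nlinarith

end Summit.QuantumFields.BalabanUV.Beta.FP.LatticeTaylorIndex

end
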